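import Summits.HodgeConjecture.CorCM.CMAbelianFourfoldPowers
import HarnessLib

/-!
# Complex abelian FOURFOLDS of CM type: the classification `B•(X) = D•(X) ⟺ ¬(a) ∧ ¬(b)` and the dichotomy
# «Hodge conjecture for all powers, or an explicit exceptional `(2,2)`-class» — Moonen–Zarhin (0.1), CM case

COR-CM (cell `pub-hodgecm2`, binder seat `b16` gen 38, count-neutral claim CM4-CLASSIF, file 3 of 3; theorems only,
no definition, no named fact).  NEW as stated (an assembly of tree theorems), hence under `Summits/`.  Sequel of
`CorCM/CMAbelianFourfoldPowers` (file 2: isogeny factors, case (a) ⟹ `D²(X) ≠ B²(X)`, and «`B = D` on a CM fourfold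
⟹ `B = D` on everything dominated by its powers») and `CorCM/CMAlgebraDegreeLeEightFamilies` (file 1, type level).

[MoonenZarhin1999LowDim, Thm. (0.1)], CM case, for a complex abelian variety `X` of CM type with `dim X = 4`, where
(a) := «there are an elliptic curve `E` and a simple abelian threefold `T`, both ISOGENY FACTORS of `X`
(`Domination.AVDominatedBy`; for `dim E + dim T = dim X`: `X ∼ E × T`), with a ring embedding `End⁰(E) ↪ End⁰(T)`»
and (b) := «`X` is simple with `dim MT(H¹(X)) = 4`» (Hazama's form of «`End⁰(X) ⊇ k` imaginary quadratic acting with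
multiplicities `(2,2)`»; lit-deligne-3's `isDivisorGenerated_iff_mtRank_eq_five_of_dim_four`):

* **`isDivisorGenerated_iff_of_not_isSimple_of_dim_four`** — a NON-SIMPLE CM fourfold is divisor-generated (equivalently,
  by file 2, all its powers are and everything dominated by a power satisfies the Hodge conjecture) iff ¬(a):
  `S × S′`, `E × E′ × S`, `E² × S`, `E₁ × ⋯ × E₄`, `E × T` with `End⁰(E) ↪̸ End⁰(T)`, … are stably divisor-generated;
  **`hodgeConjectureFor_of_avDominatedBy_powSucc_of_not_isSimple_of_dim_four`** — the Hodge conjecture there,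
  UNCONDITIONALLY (Moonen–Zarhin (0.1) (4));
* **`hodgeConjectureFor_powSucc_or_exists_exceptional_two_of_isOfCMType_of_dim_four`** — THE DICHOTOMY for EVERY CM
  fourfold: all powers divisor-generated with the Hodge conjecture, OR an explicit rational `(2,2)`-class on `X` outside
  `D²(X) ⊗ ℂ` (simple: lit-deligne-3; non-simple: the Weil class of case (a)); hence
  `isDivisorGenerated_iff_forall_two_of_isOfCMType_of_dim_four` / `…_iff_hodgeClassSpan_two_le_…` — for a CM fourfold
  `B = D` is decided in `H⁴`;
* **`isDivisorGenerated_iff_of_isOfCMType_of_dim_four`** — MOONEN–ZARHIN (0.1) ON THE VARIETY: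
  `B•(X) = D•(X) ⟺ ¬(a) ∧ ¬(b)`; a simple `X` is never in case (a) (`not_avDominatedBy_of_isSimple_of_dim_lt`, file 2).

## References

* [MoonenZarhin1999LowDim] B. Moonen, Yu. Zarhin, *Hodge classes on abelian varieties of low dimension*, Math. Ann.
  315 (1999) 711–733, Thm. (0.1) (a), (b), (1), (4) and the remark after it; §5 (5.1)–(5.2).
* [MumfordAV1970] D. Mumford, *Abelian Varieties*, §19 Thm. 1, Cor. 1–2 (pp. 173–174).
* [Gordon1999HodgeAVSurvey] B. B. Gordon, *A survey of the Hodge conjecture for abelian varieties*, 5.13, Thm. 6.4,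
  7.5–7.6, 10.10.
-/

noncomputable section

open CategoryTheory CategoryTheory.Limits NumberField
open scoped BigOperators

namespace Summit.HodgeConjecture.CorCM

open Literature.NumberTheory.ComplexMultiplication
open Literature.AlgebraicGeometry.Motives (AbelianVariety CMType)
open Literature.AlgebraicGeometry.Motives.AbelianVariety
open Literature.AlgebraicGeometry.HodgeTheory
open Literature.AlgebraicGeometry.ComplexMultiplication
open Literature.AlgebraicGeometry.VanGeemen1994 (hodgeClassSpan)
open Literature.AlgebraicGeometry.Milne1999
open Literature.AlgebraicGeometry.Pohlmann1968
open Literature.Barriers.HodgeConjecture (divisorClassesSpan)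
open Summit.HodgeConjecture.CorCM.Domination
open Summit.HodgeConjecture.HodgeConjecture.Ring2.Atlas (nonempty_ringEquiv_endAlgebra_of_isSimple)

/-! ## §5 The classification: `B = D` iff neither case (a) nor case (b) -/

section Classification

variable {X : AbelianVariety ℂ}

/-- **A NON-SIMPLE complex abelian fourfold of CM type is divisor-generated — equivalently (§4) all its powers are, and
the Hodge conjecture holds for everything dominated by a power — iff it is NOT in Moonen–Zarhin's case (a)**: there are
no elliptic curve `E` and simple abelian threefold `T`, both isogeny factors of `X`, with `End⁰(E) ↪ End⁰(T)`.
(`S × S′`, `E × E′ × S`, `E² × S`, `E₁ × ⋯ × E₄`, `E × T` with `k ↪̸ K_T`, … are all stably divisor-generated.)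
Proof of ⟸: in the regrouping the curve/threefold slots inherit no embedding (their `End⁰` are the fields,
`Ring2.Atlas.nonempty_ringEquiv_endAlgebra_of_isSimple`, and the slots are isogeny factors of `X`), and an octic slot would make
`X` simple (a non-zero `X → A'_b` between varieties of dimension `4`, `A'_b` simple, is an isogeny); so the family is
nondegenerate (file 1) and `B = D` on `⨁ᵢ A'_{cls i} ≽ X`. [cite: MoonenZarhin1999LowDim, Thm. (0.1) (a), (1), (4)]
[cite: MumfordAV1970, §19 Cor. 1–2] -/
theorem isDivisorGenerated_iff_of_not_isSimple_of_dim_four (hcm : IsOfCMType X) (h4 : X.dim = 4)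
    (hns : ¬ X.IsSimple) :
    IsDivisorGenerated X ↔ ¬ ∃ E T : AbelianVariety ℂ, E.dim = 1 ∧ T.IsSimple ∧ T.dim = 3 ∧
      AVDominatedBy E X ∧ AVDominatedBy T X ∧ Nonempty (E.endAlgebra →+* T.endAlgebra) := by
  classical
  refine ⟨fun hD ⟨E, T, hE, hT, hT3, hEX, hTX, ⟨e⟩⟩ =>
    not_isDivisorGenerated_of_curve_threefold_factors hcm h4 hE hT hT3 hEX hTX e hD, fun hna => ?_⟩
  obtain ⟨C, _, K', _, _, _, Φ', A', ι', θ', m, cls, f, hA, hs, hniso, hcls, hf⟩ :=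
    exists_isIsogeny_biproduct_of_isSimple_of_isOfCMType (X := X) (by omega) hcm
  haveI : Nonempty C := ⟨cls 0⟩
  have hsum : ∑ c, (A' c).dim ≤ 4 := (sum_dim_le_dim_of_isIsogeny_biproduct hcls hf).trans h4.le
  have hXP : AVDominatedBy X (⨁ fun i => A' (cls i)) := AVDominatedBy.of_isIsogeny_hom hf (AVDominatedBy.refl _)
  have hPX : AVDominatedBy (⨁ fun i => A' (cls i)) X := AVDominatedBy.of_isIsogeny_inv hf (AVDominatedBy.refl _)
  have hslot : ∀ i, AVDominatedBy (A' (cls i)) X := fun i =>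
    (avDominatedBy_biproduct_summand (fun i => A' (cls i)) i).trans hPX
  -- (¬a) on the representatives
  have hfor : ∀ a b, a ≠ b → (A' a).dim = 1 → (A' b).dim = 3 → IsEmpty (K' a →+* K' b) := by
    intro a b _ ha hb
    by_contra hne
    rw [not_isEmpty_iff] at hne
    obtain ⟨e⟩ := hne
    obtain ⟨ia, rfl⟩ := hcls a
    obtain ⟨ib, rfl⟩ := hcls b
    obtain ⟨eE⟩ := nonempty_ringEquiv_endAlgebra_of_isSimple (hA (cls ia)) (hs (cls ia))
    obtain ⟨eT⟩ := nonempty_ringEquiv_endAlgebra_of_isSimple (hA (cls ib)) (hs (cls ib))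
    exact hna ⟨A' (cls ia), A' (cls ib), ha, hs (cls ib), hb, hslot ia, hslot ib,
      ⟨eT.toRingHom.comp (e.comp eE.symm.toRingHom)⟩⟩
  -- (¬b) on the representatives: an octic slot would make `X` simple
  have hoct : ∀ b, (A' b).dim = 4 → IsNondegenerate (Φ' b) := by
    intro b hb
    obtain ⟨ib, rfl⟩ := hcls b
    exfalso
    obtain ⟨s, π, N, hN, hsπ⟩ := hslot ib
    have hπ : π ≠ 0 := (ne_zero_of_comp_eq_nsmul_id hN hsπ (by omega)).2
    have hiso : IsIsogeny π := isIsogeny_of_isSimple_of_ne_zero_of_dim_eq π (hs (cls ib)) hπ (by omega)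
    exact hns ((hs (cls ib)).of_isIsogenous (IsIsogenous.symm' ⟨π, hiso⟩))
  refine isDivisorGenerated_of_avDominatedBy hXP fun p c hcQ hcH => ?_
  rw [← hodgeClassSpan_prod_eq_divisorClassesSpan_of_sum_dim_le_four hA hs hniso hsum hfor hoct cls p]
  exact Submodule.subset_span ⟨hcQ, hcH⟩

/-- **Not in case (a) and not simple ⟹ all powers divisor-generated and the Hodge conjecture for everything dominated
by a power**, UNCONDITIONALLY (Moonen–Zarhin (0.1) (4), CM case, non-simple fourfolds).
[cite: MoonenZarhin1999LowDim, Thm. (0.1) (4)] [cite: Gordon1999HodgeAVSurvey, 10.10] -/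
theorem hodgeConjectureFor_of_avDominatedBy_powSucc_of_not_isSimple_of_dim_four {B : AbelianVariety ℂ} {N : ℕ}
    (hcm : IsOfCMType X) (h4 : X.dim = 4) (hns : ¬ X.IsSimple)
    (hna : ¬ ∃ E T : AbelianVariety ℂ, E.dim = 1 ∧ T.IsSimple ∧ T.dim = 3 ∧
      AVDominatedBy E X ∧ AVDominatedBy T X ∧ Nonempty (E.endAlgebra →+* T.endAlgebra))
    (hB : AVDominatedBy B (X.powSucc N)) : IsDivisorGenerated B ∧ HodgeConjectureFor B.dim B.X :=
  have hX := (isDivisorGenerated_iff_of_not_isSimple_of_dim_four hcm h4 hns).2 hna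
  ⟨isDivisorGenerated_of_avDominatedBy_powSucc_of_isOfCMType_of_dim_four hcm h4 hX hB,
    hodgeConjectureFor_of_avDominatedBy_powSucc_of_isDivisorGenerated_of_dim_four hcm h4 hX hB⟩

/-- **THE DICHOTOMY for every complex abelian fourfold of CM type**: EITHER all powers `X^{N+1}` are divisor-generated
and satisfy the Hodge conjecture (unconditionally), OR `X` carries an explicit rational `(2,2)`-class OUTSIDE
`D²(X) ⊗ ℂ` (simple `X`: lit-deligne-3; non-simple `X`: case (a), the Weil class of the curve field).
[cite: MoonenZarhin1999LowDim, Thm. (0.1)] [cite: Gordon1999HodgeAVSurvey, 5.13, 7.5 and 10.10] -/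
theorem hodgeConjectureFor_powSucc_or_exists_exceptional_two_of_isOfCMType_of_dim_four (hcm : IsOfCMType X)
    (h4 : X.dim = 4) :
    (∀ N : ℕ, IsDivisorGenerated (X.powSucc N) ∧ HodgeConjectureFor (X.powSucc N).dim (X.powSucc N).X) ∨
      ∃ c : complexBetti X.X (2 * 2), IsRationalClass c ∧ IsOfHodgeType X.dim X.X (2 * 2) 2 2 c ∧
        c ∉ divisorClassesSpan X.X X.dim 2 := by
  by_cases hX : IsDivisorGenerated X
  · exact Or.inl fun N =>
      ⟨isDivisorGenerated_of_avDominatedBy_powSucc_of_isOfCMType_of_dim_four hcm h4 hX (AVDominatedBy.refl _),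
        hodgeConjectureFor_powSucc_of_isDivisorGenerated_of_dim_four hcm h4 hX N⟩
  · right
    by_cases hXs : X.IsSimple
    · exact (hodgeConjectureFor_powSucc_or_exists_exceptional_two_of_dim_four hXs h4 hcm).resolve_left
        fun h => hX (h 0).1
    · have hna := mt (isDivisorGenerated_iff_of_not_isSimple_of_dim_four hcm h4 hXs).2 hX
      push Not at hna
      obtain ⟨E, T, hE, hT, hT3, hEX, hTX, ⟨e⟩⟩ := hna
      exact exists_exceptional_two_of_curve_threefold_factors hcm h4 hE hT hT3 hEX hTX e

/-- **For a complex abelian fourfold of CM type, `B = D` is decided in `H⁴`**: `X` is divisor-generated iff every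
rational `(2,2)`-class on `X` lies in `D²(X) ⊗ ℂ` (Moonen–Zarhin: in the exceptional cases (a), (b) already
«`D²(X) ≠ B²(X)`»; all other degrees take care of themselves). [cite: MoonenZarhin1999LowDim, Thm. (0.1) (1) and the remark after (4)]
[cite: Gordon1999HodgeAVSurvey, 5.13] -/
theorem isDivisorGenerated_iff_forall_two_of_isOfCMType_of_dim_four (hcm : IsOfCMType X) (h4 : X.dim = 4) :
    IsDivisorGenerated X ↔ ∀ c : complexBetti X.X (2 * 2), IsRationalClass c →
      IsOfHodgeType X.dim X.X (2 * 2) 2 2 c → c ∈ divisorClassesSpan X.X X.dim 2 := by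
  refine ⟨fun h c hcQ hcH => h 2 c hcQ hcH, fun h => ?_⟩
  by_contra hX
  rcases hodgeConjectureFor_powSucc_or_exists_exceptional_two_of_isOfCMType_of_dim_four hcm h4 with hall | ⟨c, hcQ, hcH, hcD⟩
  · exact hX (hall 0).1
  · exact hcD (h c hcQ hcH)

/-- **Span form: a CM fourfold is divisor-generated iff `B²(X) ⊗ ℂ ⊆ D²(X) ⊗ ℂ`** (`hodgeClassSpan` in degree `2`).
[cite: MoonenZarhin1999LowDim, Thm. (0.1) (1) and the remark after (4)] -/
theorem isDivisorGenerated_iff_hodgeClassSpan_two_le_of_isOfCMType_of_dim_four (hcm : IsOfCMType X) (h4 : X.dim = 4) :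
    IsDivisorGenerated X ↔ hodgeClassSpan X.dim X.X 2 ≤ divisorClassesSpan X.X X.dim 2 := by
  rw [isDivisorGenerated_iff_forall_two_of_isOfCMType_of_dim_four hcm h4]
  exact ⟨fun h => Submodule.span_le.2 fun c hc => h c hc.1 hc.2, fun h c hcQ hcH => h (Submodule.subset_span ⟨hcQ, hcH⟩)⟩

variable [Literature.AlgebraicGeometry.Motives.HodgeTensorFacts.{0, 0}] {n : ℕ} (hXn : Literature.AlgebraicGeometry.Motives.IsSmoothProjective n X.X)

/-- **MOONEN–ZARHIN (0.1), CM CASE, ON THE VARIETY.**  A complex abelian variety `X` of CM type with `dim X = 4` is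
divisor-generated — equivalently all its powers are (`isDivisorGenerated_iff_forall_powSucc_of_isOfCMType_of_dim_four`),
and then everything dominated by a power satisfies the Hodge conjecture unconditionally — iff
(¬a) there are NO elliptic curve `E` and simple abelian threefold `T`, both isogeny factors of `X`, with
`End⁰(E) ↪ End⁰(T)`, and (¬b) if `X` is simple then `dim MT(H¹(X)) = 5` (Hazama's form of «`End⁰(X) ⊇ k` acting with
multiplicities `(2,2)`»: for a simple CM fourfold `dim MT ∈ {4, 5}`, and `4` is case (b), lit-deligne-3's
`isDivisorGenerated_iff_mtRank_eq_five_of_dim_four`).  A simple `X` is never in case (a)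
(`not_avDominatedBy_of_isSimple_of_dim_lt`). [cite: MoonenZarhin1999LowDim, Thm. (0.1) (a), (b), (1), (4)]
[cite: Gordon1999HodgeAVSurvey, 5.13 and Thm. 6.4] -/
theorem isDivisorGenerated_iff_of_isOfCMType_of_dim_four (hcm : IsOfCMType X) (h4 : X.dim = 4) :
    haveI := BettiUniverse.finite hXn 1
    IsDivisorGenerated X ↔
      (¬ ∃ E T : AbelianVariety ℂ, E.dim = 1 ∧ T.IsSimple ∧ T.dim = 3 ∧
          AVDominatedBy E X ∧ AVDominatedBy T X ∧ Nonempty (E.endAlgebra →+* T.endAlgebra)) ∧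
        (X.IsSimple → (BettiUniverse.hodge exists_isReal_hodgeModel_holds hXn 1).mtRank = 5) := by
  by_cases hXs : X.IsSimple
  · have hna : ¬ ∃ E T : AbelianVariety ℂ, E.dim = 1 ∧ T.IsSimple ∧ T.dim = 3 ∧
        AVDominatedBy E X ∧ AVDominatedBy T X ∧ Nonempty (E.endAlgebra →+* T.endAlgebra) :=
      fun ⟨E, T, hE, _, _, hEX, _, _⟩ =>
        not_avDominatedBy_of_isSimple_of_dim_lt hXs (isSimple_of_dim_le_one (by omega)) (by omega) (by omega) hEX
    rw [isDivisorGenerated_iff_mtRank_eq_five_of_dim_four hXn hXs h4 hcm]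
    exact ⟨fun h => ⟨hna, fun _ => h⟩, fun h => h.2 hXs⟩
  · rw [isDivisorGenerated_iff_of_not_isSimple_of_dim_four hcm h4 hXs]
    exact ⟨fun h => ⟨h, fun h' => (hXs h').elim⟩, fun h => h.1⟩

end Classification

end Summit.HodgeConjecture.CorCM

end
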